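import Literature.Computability.Complexity.GenPrograms
import HarnessLib

/-!
# Generator programs with access to the input bits

`GenPrograms.lean` proves once and for all that *generator programs* (nested counted loops
emitting literal words, `GStmt`) produce polynomial-time streams of the input *length*. A Karp
reduction `x ↦ φₓ` (Cook–Levin: Cook 1971, Thm. 1; Arora–Barak 2009, Lemma 2.11, "the function
`x ↦ φₓ` is polynomial-time computable"; Sipser 2012, proof of Thm. 7.37, last paragraph) also
copies the bits of `x` into its output, each bit inside a context that depends on its position.
This file adds the corresponding combinator and proves it polynomial-time on Mathlib's `TM2`
model, by one structured stack program (`StackPrograms.lean`) in the register conventions of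
`GenPrograms.lean`:

* `bitsOut env c st sf z m` — the stream of the **bit loop**: for the bits `b₀ b₁ …` of `z`, in
  order, the stream of the generator statement `st` (if `bᵢ = true`) or `sf` (if `bᵢ = false`)
  in the environment `env[c ↦ m + i]` (a running bit counter `c`).
* `progI` — count the input length into `x₀` keeping the input, run `P₁`, run the bit loop, reset
  the counter, run `P₃`, pour out; `progI_runs` — its exact effect and a cost bound;
* `out_mem_FP_input` — **the stream `P₁.out (x₀ ↦ |z|) ++ bitsOut … z 0 ++ P₃.out (x₀ ↦ |z|)` is
  in `FP`** as a function of `z`.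

So a uniformity proof for a reduction again reduces to an identity between a generated stream
and the intended output (used in `CookLevinReduction.lean`).

## References

* S. Arora, B. Barak, *Computational Complexity: A Modern Approach*, CUP 2009, Lemma 2.11 and
  §1.3; proof of Thm. 6.15 ("keeping counters").
* M. Sipser, *Introduction to the Theory of Computation*, 3rd ed., 2012, Thm. 7.37 (proof, the
  reduction is computable in polynomial time).
* T. Nipkow, G. Klein, *Concrete Semantics with Isabelle/HOL*, Springer 2014, Ch. 7–8.
-/

namespace Literature.Computability.Complexity

open _root_.Computability Polynomial

namespace GenProg

variable {V : Type} [DecidableEq V] {D : ℕ}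

/-- The one-bit letter code of the Boolean output alphabet. [folklore] -/
def bitCode : Bool → List Bool := fun b => [b]

/-- Coding a bit stream letter by letter is the identity. [folklore] -/
@[simp] theorem flatMap_bitCode (w : List Bool) : w.flatMap bitCode = w := by
  induction w with
  | nil => rfl
  | cons b w ih => simp [bitCode, ih]

/-! ### The bit loop -/

/-- **The stream of the bit loop**: bit `i` of `z` (counting from `m`) contributes the stream of
`st` or `sf` (according to the bit) in the environment with the bit counter `c` set to `m + i`.
[Arora–Barak 2009, Lemma 2.11 (proof)] [folklore] -/
def bitsOut (env : V → ℕ) (c : V) (st sf : GStmt V Bool) : List Bool → ℕ → List Bool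
  | [], _ => []
  | b :: z, m => (cond b st sf).out (Function.update env c m) ++ bitsOut env c st sf z (m + 1)

/-- The exact cost of the bit loop. [folklore] -/
def bitsCost (env : V → ℕ) (c : V) (st sf : GStmt V Bool) : List Bool → ℕ → ℕ
  | [], _ => 1
  | b :: z, m => (cond b st sf).cost bitCode (Function.update env c m) + 1 + 2 +
      bitsCost env c st sf z (m + 1)

/-- The compiled bit loop: pop the input bit by bit; on each bit run the compiled statement for
that bit and increment the bit counter. [Arora–Barak 2009, Lemma 2.11 (proof)] [folklore] -/
def bitLoop (c : V) (st sf : GStmt V Bool) : Com (GReg V D) :=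
  Com.loop GReg.inp (stmtC bitCode st 0 ;; Com.push (GReg.main c) true)
    (stmtC bitCode sf 0 ;; Com.push (GReg.main c) true)

/-- The stream of the bit loop is no longer than its cost. [folklore] -/
theorem length_bitsOut_le (env : V → ℕ) (c : V) (st sf : GStmt V Bool) :
    ∀ (z : List Bool) (m : ℕ), (bitsOut env c st sf z m).length ≤ bitsCost env c st sf z m
  | [], m => by simp [bitsOut, bitsCost]
  | b :: z, m => by
    simp only [bitsOut, bitsCost, List.length_append]
    have h1 := (cond b st sf).length_out_le bitCode (Function.update env c m)
    have h2 := length_bitsOut_le env c st sf z (m + 1)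
    rw [flatMap_bitCode] at h1
    omega

/-- The cost of the bit loop is polynomially bounded: with all variables and `m + |z|` at most
`U`, it is at most `|z| · (cpoly st + cpoly sf + 3)(U) + 1`. [folklore] -/
theorem bitsCost_le (env : V → ℕ) (c : V) (st sf : GStmt V Bool) {U : ℕ} (hU : ∀ y, env y ≤ U) :
    ∀ (z : List Bool) (m : ℕ), m + z.length ≤ U →
      bitsCost env c st sf z m ≤
        z.length * ((st.cpoly bitCode).eval U + (sf.cpoly bitCode).eval U + 3) + 1
  | [], m, _ => by simp [bitsCost]
  | b :: z, m, hm => by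
    simp only [bitsCost, List.length_cons] at hm ⊢
    have henv : ∀ y, Function.update env c m y ≤ U := by
      intro y
      rcases eq_or_ne y c with rfl | h
      · simp; omega
      · rw [Function.update_of_ne h]; exact hU y
    have h1 := st.cost_le bitCode henv
    have h2 := sf.cost_le bitCode henv
    have ih := bitsCost_le env c st sf hU z (m + 1) (by omega)
    cases b <;> simp only [cond_true, cond_false] <;> nlinarith

/-- **Adequacy of the bit loop**: from a file holding `env[c ↦ m]` in unary (the loop indices of
`st`, `sf` being `0`, `c` not among them), empty counters and scratch, and `z` in the input
register, the bit loop consumes the input, pushes the (reversed) stream `bitsOut … z m` on the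
output register and leaves `env[c ↦ m + |z|]`. [Nipkow–Klein 2014, Ch. 7] [folklore] -/
theorem runs_bitLoop (env : V → ℕ) (c : V) (st sf : GStmt V Bool)
    (hst : st.noReuse = true) (hsf : sf.noReuse = true) (hDt : st.depth ≤ D) (hDf : sf.depth ≤ D)
    (hct : c ∉ st.loopVars) (hcf : c ∉ sf.loopVars)
    (h0t : ∀ j ∈ st.loopVars, env j = 0) (h0f : ∀ j ∈ sf.loopVars, env j = 0) (r : List Bool) :
    ∀ (z : List Bool) (m : ℕ) (o : List Bool),
    Com.Runs (bitLoop c st sf : Com (GReg V D))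
      (mk (unary (Function.update env c m)) (fun _ => []) [] o r z)
      (mk (unary (Function.update env c (m + z.length))) (fun _ => []) []
        ((bitsOut env c st sf z m).reverse ++ o) r [])
      (bitsCost env c st sf z m)
  | [], m, o => by
    unfold bitLoop
    simpa [bitsOut, bitsCost] using Com.Runs.loop_nil
      (R := (mk (unary (Function.update env c m)) (fun _ => []) [] o r [] : Regs (GReg V D)))
      (stmtC bitCode st 0 ;; Com.push (GReg.main c) true)
      (stmtC bitCode sf 0 ;; Com.push (GReg.main c) true) rfl
  | b :: z, m, o => by
    unfold bitLoop
    -- the body on this bit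
    have hbody : ∀ (s : GStmt V Bool), s.noReuse = true → s.depth ≤ D → c ∉ s.loopVars →
        (∀ j ∈ s.loopVars, env j = 0) →
        Com.Runs (stmtC bitCode s 0 ;; Com.push (GReg.main c) true : Com (GReg V D))
          (mk (unary (Function.update env c m)) (fun _ => []) [] o r z)
          (mk (unary (Function.update env c (m + 1))) (fun _ => []) []
            ((s.out (Function.update env c m)).reverse ++ o) r z)
          (s.cost bitCode (Function.update env c m) + 1) := by
      intro s hs hD hc h0
      have h1 := stmtC_runs (D := D) bitCode s hs (φ := 0) (by omega) (Function.update env c m)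
        (fun j hj => by
          rw [Function.update_of_ne (fun h => by subst h; exact hc hj)]; exact h0 j hj)
        (fun _ => []) (fun _ _ => rfl) o r z
      rw [flatMap_bitCode] at h1
      have h2 := Com.Runs.push (GReg.main c) true
        (mk (unary (Function.update env c m)) (fun _ => []) []
          ((s.out (Function.update env c m)).reverse ++ o) r z : Regs (GReg V D))
      rw [update_mk_main, mk_main] at h2
      have e : Function.update (unary (Function.update env c m)) c
          (true :: unary (Function.update env c m) c) = unary (Function.update env c (m + 1)) := by
        rw [unary_update, unary_update, Function.update_idem]
        simp [List.replicate_succ]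
      rw [e] at h2
      exact h1.seq h2
    have ih := runs_bitLoop env c st sf hst hsf hDt hDf hct hcf h0t h0f r z (m + 1)
    unfold bitLoop at ih
    have hk : (mk (unary (Function.update env c m)) (fun _ => []) [] o r (b :: z) : Regs (GReg V D))
        GReg.inp = b :: z := rfl
    simp only [bitsOut, bitsCost, List.reverse_append, List.length_cons]
    rw [show m + (z.length + 1) = m + 1 + z.length by omega]
    cases b
    · have h1 := hbody sf hsf hDf hcf h0f
      have := Com.Runs.loop_false hk (by rw [update_mk_inp]; exact h1)
        (ih (((cond false st sf).out (Function.update env c m)).reverse ++ o))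
      simp only [cond_false, List.append_assoc] at this ⊢
      exact this.mono (le_of_eq (by omega))
    · have h1 := hbody st hst hDt hct h0t
      have := Com.Runs.loop_true hk (by rw [update_mk_inp]; exact h1)
        (ih (((cond true st sf).out (Function.update env c m)).reverse ++ o))
      simp only [cond_true, List.append_assoc] at this ⊢
      exact this.mono (le_of_eq (by omega))

/-! ### Keeping the input while counting it, and resetting a counter -/

/-- Count the input length into `x₀`, stashing the bits (reversed) in the result register.
[folklore] -/
def countKeep (x₀ : V) : Com (GReg V D) :=
  Com.loop GReg.inp (Com.push (GReg.main x₀) true ;; Com.push GReg.res true)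
    (Com.push (GReg.main x₀) true ;; Com.push GReg.res false)

/-- Move the stashed bits back to the input register (restoring their order). [folklore] -/
def restore : Com (GReg V D) :=
  Com.loop GReg.res (Com.push GReg.inp true) (Com.push GReg.inp false)

/-- Counting the input while stashing it. [folklore] -/
theorem runs_countKeep (x₀ : V) (cs : ℕ → List Bool) (t o : List Bool) :
    ∀ (w : List Bool) (m : ℕ) (r : List Bool),
    Com.Runs (countKeep x₀ : Com (GReg V D))
      (mk (unary (initEnv x₀ m)) cs t o r w)
      (mk (unary (initEnv x₀ (m + w.length))) cs t o (w.reverse ++ r) [])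
      (4 * w.length + 1)
  | [], m, r => by
    unfold countKeep
    simpa using Com.Runs.loop_nil (R := (mk (unary (initEnv x₀ m)) cs t o r [] : Regs (GReg V D)))
      (Com.push (GReg.main x₀) true ;; Com.push GReg.res true)
      (Com.push (GReg.main x₀) true ;; Com.push GReg.res false) rfl
  | b :: w, m, r => by
    unfold countKeep
    have e1 : ∀ r' : List Bool, Function.update (mk (unary (initEnv x₀ m)) cs t o r' w : Regs (GReg V D))
        (GReg.main x₀) (true :: (mk (unary (initEnv x₀ m)) cs t o r' w : Regs (GReg V D)) (GReg.main x₀)) =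
        mk (unary (initEnv x₀ (m + 1))) cs t o r' w := by
      intro r'
      rw [update_mk_main, mk_main]
      congr 1
      simp only [initEnv, Function.update_idem, unary_update, unary_apply, Function.update_self]
      simp [List.replicate_succ]
    have h1 := Com.Runs.push (GReg.main x₀) true (mk (unary (initEnv x₀ m)) cs t o r w : Regs (GReg V D))
    rw [e1] at h1
    have h2 := Com.Runs.push GReg.res b (mk (unary (initEnv x₀ (m + 1))) cs t o r w : Regs (GReg V D))
    rw [update_mk_res, mk_res] at h2
    have ih := runs_countKeep x₀ cs t o w (m + 1) (b :: r)
    unfold countKeep at ih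
    rw [show m + 1 + w.length = m + (b :: w).length by simp; omega,
      show w.reverse ++ b :: r = (b :: w).reverse ++ r by simp] at ih
    have hk : (mk (unary (initEnv x₀ m)) cs t o r (b :: w) : Regs (GReg V D)) GReg.inp = b :: w := rfl
    cases b
    · exact (Com.Runs.loop_false hk (by rw [update_mk_inp]; exact h1.seq h2) ih).mono (by simp; omega)
    · exact (Com.Runs.loop_true hk (by rw [update_mk_inp]; exact h1.seq h2) ih).mono (by simp; omega)

/-- Restoring the input from the stash. [folklore] -/
theorem runs_restore (ms : V → List Bool) (cs : ℕ → List Bool) (t o : List Bool) :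
    ∀ (w i : List Bool),
    Com.Runs (restore : Com (GReg V D)) (mk ms cs t o w i) (mk ms cs t o [] (w.reverse ++ i))
      (3 * w.length + 1)
  | [], i => by
    unfold restore
    simpa using Com.Runs.loop_nil (R := (mk ms cs t o [] i : Regs (GReg V D)))
      (Com.push GReg.inp true) (Com.push GReg.inp false) rfl
  | b :: w, i => by
    unfold restore
    have ih := runs_restore ms cs t o w (b :: i)
    unfold restore at ih
    rw [show w.reverse ++ b :: i = (b :: w).reverse ++ i by simp] at ih
    have hk : (mk ms cs t o (b :: w) i : Regs (GReg V D)) GReg.res = b :: w := rfl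
    cases b
    · have h1 := Com.Runs.push GReg.inp false (mk ms cs t o w i : Regs (GReg V D))
      rw [update_mk_inp, mk_inp] at h1
      exact (Com.Runs.loop_false hk (by rw [update_mk_res]; exact h1) ih).mono (by simp; omega)
    · have h1 := Com.Runs.push GReg.inp true (mk ms cs t o w i : Regs (GReg V D))
      rw [update_mk_inp, mk_inp] at h1
      exact (Com.Runs.loop_true hk (by rw [update_mk_res]; exact h1) ih).mono (by simp; omega)

/-- Resetting a unary variable register to `0`. [folklore] -/
theorem runs_reset (env : V → ℕ) (c : V) (cs : ℕ → List Bool) (t o r i : List Bool) :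
    ∀ m : ℕ, Com.Runs (loopC (GReg.main c) Com.skip : Com (GReg V D))
      (mk (unary (Function.update env c m)) cs t o r i)
      (mk (unary (Function.update env c 0)) cs t o r i) (2 * m + 1)
  | 0 => by
    have hk : (mk (unary (Function.update env c 0)) cs t o r i : Regs (GReg V D)) (GReg.main c) = [] := by
      simp
    simpa using Com.Runs.loop_nil (R := (mk (unary (Function.update env c 0)) cs t o r i :
      Regs (GReg V D))) Com.skip Com.skip hk
  | m + 1 => by
    have hk : (mk (unary (Function.update env c (m + 1))) cs t o r i : Regs (GReg V D)) (GReg.main c) =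
        true :: List.replicate m true := by
      simp [List.replicate_succ]
    have e : Function.update (mk (unary (Function.update env c (m + 1))) cs t o r i : Regs (GReg V D))
        (GReg.main c) (List.replicate m true) = mk (unary (Function.update env c m)) cs t o r i := by
      rw [update_mk_main, unary_update, unary_update, Function.update_idem]
    have h1 := Com.Runs.skip (mk (unary (Function.update env c m)) cs t o r i : Regs (GReg V D))
    have ih := runs_reset env c cs t o r i m
    exact (Com.Runs.loop_true hk (by rw [e]; exact h1) ih).mono (by omega)

/-! ### The whole program -/

/-- **The generator with input access**: count the input (keeping it), run `P₁`, run the bit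
loop with counter `c` and bodies `st`/`sf`, reset `c`, run `P₃`, pour the output into the result
register. [Arora–Barak 2009, Lemma 2.11 (proof)] [folklore] -/
def progI (x₀ c : V) (P₁ P₃ st sf : GStmt V Bool) : Com (GReg V D) :=
  countKeep x₀ ;; restore ;; stmtC bitCode P₁ 0 ;; bitLoop c st sf ;;
    loopC (GReg.main c) Com.skip ;; stmtC bitCode P₃ 0 ;;
    Com.loop GReg.out (Com.push GReg.res true) (Com.push GReg.res false)

/-- **The generated stream with input access**: `P₁.out (x₀ ↦ |z|) ++ bitsOut … z 0 ++
P₃.out (x₀ ↦ |z|)`. [Arora–Barak 2009, Lemma 2.11 (proof)] [folklore] -/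
def outI (x₀ c : V) (P₁ P₃ st sf : GStmt V Bool) (z : List Bool) : List Bool :=
  P₁.out (initEnv x₀ z.length) ++ bitsOut (initEnv x₀ z.length) c st sf z 0 ++
    P₃.out (initEnv x₀ z.length)

/-- Side conditions on the variables of a generator with input access: the input variable `x₀`
and the bit counter `c` are distinct and are not loop indices, and no loop index is reused.
[folklore] -/
structure WfI (x₀ c : V) (P₁ P₃ st sf : GStmt V Bool) : Prop where
  /-- `x₀ ≠ c` -/
  ne : x₀ ≠ c
  /-- `x₀` is no loop index -/
  x₀_P₁ : x₀ ∉ P₁.loopVars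
  /-- `x₀` is no loop index -/
  x₀_P₃ : x₀ ∉ P₃.loopVars
  /-- `x₀` is no loop index -/
  x₀_st : x₀ ∉ st.loopVars
  /-- `x₀` is no loop index -/
  x₀_sf : x₀ ∉ sf.loopVars
  /-- `c` is no loop index -/
  c_P₁ : c ∉ P₁.loopVars
  /-- `c` is no loop index -/
  c_P₃ : c ∉ P₃.loopVars
  /-- `c` is no loop index -/
  c_st : c ∉ st.loopVars
  /-- `c` is no loop index -/
  c_sf : c ∉ sf.loopVars
  /-- no loop index reused -/
  nr_P₁ : P₁.noReuse = true
  /-- no loop index reused -/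
  nr_P₃ : P₃.noReuse = true
  /-- no loop index reused -/
  nr_st : st.noReuse = true
  /-- no loop index reused -/
  nr_sf : sf.noReuse = true

/-- A polynomial bounding the cost of `progI` in the input length. [folklore] -/
noncomputable def costPolyI (P₁ P₃ st sf : GStmt V Bool) : Polynomial ℕ :=
  12 * X + 8 + 4 * (P₁.cpoly bitCode + P₃.cpoly bitCode +
    X * (st.cpoly bitCode + sf.cpoly bitCode + 3) + 1)

/-- **The whole run**: on input `z`, `progI` leaves the stream `outI … z` in the result register
within `costPolyI` steps. [Nipkow–Klein 2014, Ch. 7–8] [folklore] -/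
theorem progI_runs (x₀ c : V) (P₁ P₃ st sf : GStmt V Bool) (hw : WfI x₀ c P₁ P₃ st sf)
    (hD : max (max P₁.depth P₃.depth) (max st.depth sf.depth) ≤ D) (z : List Bool) :
    Com.Runs (progI x₀ c P₁ P₃ st sf : Com (GReg V D)) (Regs.init GReg.inp z)
      (mk (unary (initEnv x₀ z.length)) (fun _ => []) [] [] (outI x₀ c P₁ P₃ st sf z) [])
      ((costPolyI P₁ P₃ st sf).eval z.length) := by
  set n := z.length
  set env := initEnv x₀ n
  have henv0 : ∀ y, y ≠ x₀ → env y = 0 := fun y hy => initEnv_of_ne hy _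
  have hc0 : env c = 0 := henv0 c (Ne.symm hw.ne)
  have hupd0 : Function.update env c 0 = env := by
    rw [← hc0]; exact Function.update_eq_self c env
  rw [init_eq z x₀]
  -- count, restore
  have h1 := runs_countKeep (D := D) x₀ (fun _ => []) [] [] z 0 []
  rw [Nat.zero_add, List.append_nil] at h1
  have h2 := runs_restore (D := D) (unary env) (fun _ => []) [] [] z.reverse []
  rw [List.reverse_reverse, List.append_nil, List.length_reverse] at h2
  -- P₁
  have h3 := stmtC_runs (D := D) bitCode P₁ hw.nr_P₁ (φ := 0) (by omega) env
    (fun j hj => henv0 j (fun h => by subst h; exact hw.x₀_P₁ hj)) (fun _ => []) (fun _ _ => rfl) [] [] z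
  rw [flatMap_bitCode, List.append_nil] at h3
  -- bit loop
  have h4 := runs_bitLoop (D := D) env c st sf hw.nr_st hw.nr_sf (by omega) (by omega) hw.c_st hw.c_sf
    (fun j hj => henv0 j (fun h => by subst h; exact hw.x₀_st hj))
    (fun j hj => henv0 j (fun h => by subst h; exact hw.x₀_sf hj)) [] z 0 (P₁.out env).reverse
  rw [hupd0, Nat.zero_add] at h4
  -- reset
  have h5 := runs_reset (D := D) env c (fun _ => []) [] ((bitsOut env c st sf z 0).reverse ++
    (P₁.out env).reverse) [] [] n
  rw [hupd0] at h5
  -- P₃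
  have h6 := stmtC_runs (D := D) bitCode P₃ hw.nr_P₃ (φ := 0) (by omega) env
    (fun j hj => henv0 j (fun h => by subst h; exact hw.x₀_P₃ hj)) (fun _ => []) (fun _ _ => rfl)
    ((bitsOut env c st sf z 0).reverse ++ (P₁.out env).reverse) [] []
  rw [flatMap_bitCode] at h6
  -- pour
  have h7 := runs_pour (D := D) (unary env) (fun _ => []) [] []
    ((P₃.out env).reverse ++ ((bitsOut env c st sf z 0).reverse ++ (P₁.out env).reverse)) []
  simp only [List.reverse_append, List.reverse_reverse, List.append_nil, List.length_append,
    List.length_reverse, List.append_assoc] at h7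
  have hrun := h1.seq (h2.seq (h3.seq (h4.seq (h5.seq (h6.seq h7)))))
  refine (hrun.congr ?_).mono ?_
  · simp [outI, env, n, List.append_assoc]
  · -- the cost bound
    have hU : ∀ y, env y ≤ n := initEnv_le x₀ n
    have c1 := P₁.cost_le bitCode hU
    have c3 := P₃.cost_le bitCode hU
    have cb := bitsCost_le env c st sf hU z 0 (by omega)
    have l1 := P₁.length_out_le bitCode env
    have l3 := P₃.length_out_le bitCode env
    have lb := length_bitsOut_le env c st sf z 0
    rw [flatMap_bitCode] at l1 l3
    simp only [costPolyI, eval_add, eval_mul, eval_ofNat, eval_X, eval_one]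
    nlinarith [c1, c3, cb, l1, l3, lb]

/-- **Generators with input access produce `FP` streams**: for well-formed variable data, the
stream `z ↦ P₁.out (x₀ ↦ |z|) ++ bitsOut … z 0 ++ P₃.out (x₀ ↦ |z|)` is in `FP`
(Arora–Barak 2009, Lemma 2.11: "`x ↦ φₓ` is polynomial-time computable"; §1.3).
[cite: AroraBarakCC2009, Lemma 2.11] -/
theorem outI_mem_FP [Fintype V] (x₀ c : V) (P₁ P₃ st sf : GStmt V Bool)
    (hw : WfI x₀ c P₁ P₃ st sf) : outI x₀ c P₁ P₃ st sf ∈ FP := by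
  refine Com.mem_FP (ι := GReg V (max (max P₁.depth P₃.depth) (max st.depth sf.depth)))
    (progI x₀ c P₁ P₃ st sf) GReg.inp GReg.res (costPolyI P₁ P₃ st sf) _ fun z =>
      ⟨_, Or.inl (progI_runs x₀ c P₁ P₃ st sf hw le_rfl z), rfl⟩

end GenProg

end Literature.Computability.Complexity
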